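import Summits.MatrixMultiplication.MatrixMultiplication.Theorems.SoloInformedCwTwoCertificates
import Summits.MatrixMultiplication.MatrixMultiplication.Theorems.SoloInformedCwTwoAsymptoticSubrank
import Literature.Computability.AlgebraicComplexity.BorderRankCWProofs
import Literature.Computability.AlgebraicComplexity.GroupAlgebraTensor
import Literature.Computability.AlgebraicComplexity.TensorRestrictionRank
import Literature.Computability.AlgebraicComplexity.BorderRankRestriction

/-!
# Door D1 in additive-combinatorial coordinates: the nontrivial-progression tensor of `𝔽₃ⁿ`

Solo seat `solo-MatrixMultiplication-informed` (gen 3). Let `AP ∈ ℂ³ ⊗ ℂ³ ⊗ ℂ³` be the `0/1` tensor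
of the NONTRIVIAL three-term arithmetic progressions of `𝔽₃ = ℤ/3`:

  `AP(a, b, c) = 1 ⟺ (a, b, c) = (x, x + d, x + 2d)` with `d ≠ 0 ⟺ a, b, c` pairwise distinct,

equivalently `AP = 𝟙[a + b + c = 0] − 𝟙[a = b = c]` (the group law tensor of `ℤ/3` minus the
diagonal `⟨3⟩`; `ThreeAP.apTensor_eq_sumZero_sub_unit`), equivalently the polarisation
`∑_{σ ∈ 𝔖₃} e_{σ(0)} ⊗ e_{σ(1)} ⊗ e_{σ(2)}` of the square-free monomial `x₀x₁x₂` (`|ε_{abc}|`,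
`ThreeAP.apTensor_eq_abs_leviCivita`). Its Kronecker powers are the nontrivial-progression tensors
of `𝔽₃ⁿ`: `AP^{⊠n}(x, y, z) = 𝟙[y − x = z − y ∈ (𝔽₃^×)ⁿ]` (`ThreeAP.kroneckerPow_apTensor_apply`),
supported on the `3ⁿ · 2ⁿ` ordered lines `{x, x+d, x+2d}`, `d ∈ {±1}ⁿ`.

* `ThreeAP.cwTensor_two_restrictsTo_apTensor`, `ThreeAP.apTensor_restrictsTo_cwTensor_two` —
  **`T_{cw,2} ≅ AP`** (mutual restriction by explicit matrices over `ℚ(i)`: the change of basis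
  `x₁² + x₂² = (x₁ + i x₂)(x₁ − i x₂)` of CGLV §3.2, `cglv_exists_basis_cwTensor_two`, run in both
  directions); hence (`ThreeAP.asymptoticRank_apTensor_eq`, `…algBorderRank_kroneckerPow_apTensor_eq`,
  `…tensorRank_kroneckerPow_apTensor_eq`) all ranks of all Kronecker powers and the asymptotic rank
  agree, and `AP^{⊠2} = 6 · perm₃` ON THE NOSE (`ThreeAP.squareReindex_kroneckerPow_apTensor_two`;
  CGLV Lemma 2.4 `T_{cw,2}^{⊠2} ≅ perm₃` becomes an identity of arrays).
* **Door D1 restated** (`ThreeAP.matrixMultiplication_of_asymptoticRank_apTensor_le_three`,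
  `ThreeAP.asymptoticRank_apTensor_le_three_iff_certificates`):

      `ω = 2 ⟸ R̃(AP) ≤ 3 ⟺ ∀ ε > 0 ∃ n ≥ 1, bR(AP^{⊠n}) ≤ (3 + ε)ⁿ`,

  i.e. `ω = 2` follows if the `ℂ`-border rank of the nontrivial-progression tensor of `𝔽₃ⁿ` is
  `3^{n + o(n)}` — the flattening lower bound `3ⁿ` being the number of points of `𝔽₃ⁿ`.
* Kernel window transported (`ThreeAP.apTensor_window`): `3 ≤ R̃(AP) ≤ 4`, `Q̃(AP)`-side settled for
  `T_{cw,2}` (`= 3`), `3ⁿ < bR(AP^{⊠n})` for every `n ≥ 1`, `48 ≤ bR(AP^{⊠3}) (≤ 64)`; in print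
  `15 ≤ bR(AP^{⊠2}) = bR(perm₃) ≤ 16` (CGLV Thm. 1.2) and `R̃(AP) ≤ 3.9310` (Alman–Li).

Remark (informal). Over a field of characteristic `3` the FULL progression tensor `𝟙[x + y + z = 0]`
of `𝔽₃ⁿ` has slice rank `≤ 3 · #{monomials of degree ≤ 2n/3} = O(2.756ⁿ)` (Ellenberg–Gijswijt, Tao),
which is what kills STPP constructions in `𝔽₃ⁿ` (Blasiak–Church–Cohn–Grochow–Naslund–Sawin–Umans);
over `ℂ` the full tensor is `≅ ⟨3ⁿ⟩` (DFT) and the door asks for nearly optimal RANK UPPER bounds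
for its nontrivial part — a statement about `ℂ`-decompositions on which the slice-rank method is
silent (`Q̃(AP) = Q̃(T_{cw,2}) = 3` is maximal, `SoloInformedCwTwoAsymptoticSubrank`).

[cite: ConnerGesmundoLandsbergVentura2022, §3.2, Lemma 2.4, Thm. 1.2]
[cite: CoppersmithWinograd1990, §11]
[cite: ChristandlVranaZuiddam2021, Rem. 20]
-/

namespace Summit.MatrixMultiplication.MatrixMultiplication.Theorems.ThreeAP

open Literature.Computability.AlgebraicComplexity

noncomputable section

/-! ## The tensor and its three descriptions -/

/-- The **nontrivial-progression tensor of `𝔽₃`**: `1` at pairwise distinct `(a, b, c)`, else `0`.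
[folklore] -/
def apTensor : Fin 3 → Fin 3 → Fin 3 → ℂ :=
  fun a b c => if a ≠ b ∧ b ≠ c ∧ a ≠ c then 1 else 0

/-- Entries of `AP`. [folklore] -/
@[simp] theorem apTensor_apply (a b c : Fin 3) :
    apTensor a b c = if a ≠ b ∧ b ≠ c ∧ a ≠ c then 1 else 0 := rfl

/-- `AP(a,b,c) = 1` exactly on the progressions `(x, x + d, x + 2d)`, `d ≠ 0`, of `ℤ/3`. [folklore] -/
theorem apTensor_eq_ite_progression (a b c : Fin 3) :
    apTensor a b c = if b - a = c - b ∧ b - a ≠ 0 then 1 else 0 := by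
  have h : (a ≠ b ∧ b ≠ c ∧ a ≠ c) ↔ (b - a = c - b ∧ b - a ≠ 0) := by revert a b c; decide
  simp only [apTensor_apply, h]

/-- `AP = 𝟙[a + b + c = 0 ∧ ¬ (a = b = c)]` (in `ℤ/3`, `a + b + c = 0` iff `a, b, c` are all equal or
pairwise distinct). [folklore] -/
theorem apTensor_eq_ite_sumZero (a b c : Fin 3) :
    apTensor a b c = if a + b + c = 0 ∧ ¬ (a = b ∧ b = c) then 1 else 0 := by
  have h : (a ≠ b ∧ b ≠ c ∧ a ≠ c) ↔ (a + b + c = 0 ∧ ¬ (a = b ∧ b = c)) := by revert a b c; decide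
  simp only [apTensor_apply, h]

/-- **`AP = 𝟙[a + b + c = 0] − ⟨3⟩`**: the group-law tensor of `ℤ/3` minus the diagonal. [folklore] -/
theorem apTensor_eq_sumZero_sub_unit (a b c : Fin 3) :
    apTensor a b c = (if a + b + c = 0 then (1 : ℂ) else 0) - unitTensor ℂ 3 a b c := by
  have h1 : (a ≠ b ∧ b ≠ c ∧ a ≠ c) ↔ (a + b + c = 0 ∧ ¬ (a = b ∧ b = c)) := by revert a b c; decide
  have h2 : (a = b ∧ b = c) → a + b + c = 0 := by revert a b c; decide
  rw [apTensor_apply, unitTensor_apply]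
  by_cases hd : a = b ∧ b = c
  · rw [if_neg (fun h => (h1.1 h).2 hd), if_pos (h2 hd), if_pos hd]; ring
  · by_cases hs : a + b + c = 0
    · rw [if_pos (h1.2 ⟨hs, hd⟩), if_pos hs, if_neg hd]; ring
    · rw [if_neg (fun h => hs (h1.1 h).1), if_neg hs, if_neg hd]; ring

/-- **`AP = |ε|`**: the polarisation `∑_{σ ∈ 𝔖₃} e_{σ(0)} ⊗ e_{σ(1)} ⊗ e_{σ(2)}` of the monomial
`x₀x₁x₂` (the tensor CGLV §3.2 conjugate `T_{cw,2}` into).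
[cite: ConnerGesmundoLandsbergVentura2022, §3.2] -/
theorem apTensor_eq_abs_leviCivita (a b c : Fin 3) :
    apTensor a b c = ((|leviCivita3 a b c| : ℤ) : ℂ) := by
  rw [leviCivita3_eq_table]
  fin_cases a <;> fin_cases b <;> fin_cases c <;> simp [leviCivita3Table]

/-! ## Kronecker powers: the nontrivial-progression tensors of `𝔽₃ⁿ` -/

/-- **`AP^{⊠n}(x,y,z) = 𝟙[y − x = z − y` with all coordinates `≠ 0]`**: the `0/1` tensor of the
ordered lines `(x, x + d, x + 2d)`, `d ∈ (𝔽₃^×)ⁿ`, of `𝔽₃ⁿ`. [folklore] -/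
theorem kroneckerPow_apTensor_apply (n : ℕ) (x y z : Fin n → Fin 3) :
    kroneckerPow apTensor n x y z =
      if ∀ k, y k - x k = z k - y k ∧ y k - x k ≠ 0 then 1 else 0 := by
  simp only [kroneckerPow_apply, apTensor_eq_ite_progression]
  exact prod_ite_one_zero (K := ℂ) _ _ Iff.rfl

/-- Equivalently: `1` iff the three points are pairwise distinct in every coordinate. [folklore] -/
theorem kroneckerPow_apTensor_apply' (n : ℕ) (x y z : Fin n → Fin 3) :
    kroneckerPow apTensor n x y z =
      if ∀ k, x k ≠ y k ∧ y k ≠ z k ∧ x k ≠ z k then 1 else 0 := by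
  simp only [kroneckerPow_apply, apTensor_apply]
  exact prod_ite_one_zero (K := ℂ) _ _ Iff.rfl

/-- **`AP^{⊠2} = 6 · perm₃`** as arrays (after the standard reindexing `(Fin 2 → Fin 3) ≃ Fin 3 × Fin 3`):
CGLV's Lemma 2.4 `T_{cw,2}^{⊠2} ≅ perm₃` is, in these coordinates, an identity of supports.
[cite: ConnerGesmundoLandsbergVentura2022, Lemma 2.4] -/
theorem squareReindex_kroneckerPow_apTensor_two (a b c : Fin 3 × Fin 3) :
    squareReindex (kroneckerPow apTensor 2) a b c = 6 * perm3Tensor a b c := by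
  rw [squareReindex_kroneckerPow_two, apTensor_eq_abs_leviCivita, apTensor_eq_abs_leviCivita,
    perm3Tensor]
  push_cast
  ring

/-! ## `T_{cw,2} ≅ AP` -/

/-- **`T_{cw,2} ≥ AP`**: with `L = (x₀, x₁ − i x₂, x₁ + i x₂)`-type matrices over `ℚ(i)`,
`AP = ((2, 1, 1)·L-twisted) · T_{cw,2}` (CGLV §3.2: `(A,A,A)·T_{cw,2} = 2|ε|`).
[cite: ConnerGesmundoLandsbergVentura2022, §3.2] -/
theorem cwTensor_two_restrictsTo_apTensor : TensorRestrictsTo (cwTensor ℂ 2) apTensor := by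
  refine ⟨![![2, 0, 0], ![0, 1, -Complex.I], ![0, 1, Complex.I]],
    ![![1, 0, 0], ![0, 1 / 2, -Complex.I / 2], ![0, 1 / 2, Complex.I / 2]],
    ![![1, 0, 0], ![0, 1 / 2, -Complex.I / 2], ![0, 1 / 2, Complex.I / 2]], fun a' b' c' => ?_⟩
  fin_cases a' <;> fin_cases b' <;> fin_cases c' <;>
    simp [Fin.sum_univ_three, cwTensor_apply] <;> ring_nf <;> simp [Complex.I_sq] <;> ring

/-- **`AP ≥ T_{cw,2}`**: the inverse change of basis, `T_{cw,2} = ((½, 1, 1)·L) · AP` with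
`L : x ↦ (x₀, x₁ + i x₂, x₁ − i x₂)` (`x₀(x₁² + x₂²) = x₀ (x₁ + i x₂)(x₁ − i x₂)`).
[cite: ConnerGesmundoLandsbergVentura2022, §3.2] -/
theorem apTensor_restrictsTo_cwTensor_two : TensorRestrictsTo apTensor (cwTensor ℂ 2) := by
  refine ⟨![![1 / 2, 0, 0], ![0, 1 / 2, 1 / 2], ![0, Complex.I / 2, -Complex.I / 2]],
    ![![1, 0, 0], ![0, 1, 1], ![0, Complex.I, -Complex.I]],
    ![![1, 0, 0], ![0, 1, 1], ![0, Complex.I, -Complex.I]], fun a' b' c' => ?_⟩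
  fin_cases a' <;> fin_cases b' <;> fin_cases c' <;>
    simp [Fin.sum_univ_three, cwTensor_apply] <;> ring_nf <;> simp [Complex.I_sq]

/-! ## Transport of all ranks -/

/-- **`R̃` is monotone under restriction** (`t ≥ s ⇒ R̃(s) ≤ R̃(t)`; from `t^{⊗N} ≥ s^{⊗N}` and
monotonicity of rank). [cite: ChristandlVranaZuiddam2023, §1.1] -/
theorem asymptoticRank_le_of_restrictsTo {ι κ μ ι' κ' μ' : Type} [Fintype ι] [Fintype κ]
    [Fintype μ] [Fintype ι'] [Fintype κ'] [Fintype μ'] {t : ι → κ → μ → ℂ}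
    {s : ι' → κ' → μ' → ℂ} (h : TensorRestrictsTo t s) : asymptoticRank s ≤ asymptoticRank t := by
  unfold asymptoticRank
  refine ciInf_mono ⟨0, ?_⟩ fun N => ?_
  · rintro x ⟨N, rfl⟩
    positivity
  · exact Real.rpow_le_rpow (by positivity)
      (by exact_mod_cast (h.kroneckerPow (N + 1)).tensorRank_le) (by positivity)

/-- **`R̃(AP) = R̃(T_{cw,2})`.** [cite: ConnerGesmundoLandsbergVentura2022, §3.2] -/
theorem asymptoticRank_apTensor_eq : asymptoticRank apTensor = asymptoticRank (cwTensor ℂ 2) :=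
  le_antisymm (asymptoticRank_le_of_restrictsTo cwTensor_two_restrictsTo_apTensor)
    (asymptoticRank_le_of_restrictsTo apTensor_restrictsTo_cwTensor_two)

/-- **`bR(AP^{⊠n}) = bR(T_{cw,2}^{⊠n})`** for every `n`. [cite: ConnerGesmundoLandsbergVentura2022, §3.2] -/
theorem algBorderRank_kroneckerPow_apTensor_eq (n : ℕ) :
    algBorderRank (kroneckerPow apTensor n) = algBorderRank (kroneckerPow (cwTensor ℂ 2) n) :=
  le_antisymm (cwTensor_two_restrictsTo_apTensor.kroneckerPow n).algBorderRank_le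
    (apTensor_restrictsTo_cwTensor_two.kroneckerPow n).algBorderRank_le

/-- **`R(AP^{⊠n}) = R(T_{cw,2}^{⊠n})`** for every `n`. [cite: ConnerGesmundoLandsbergVentura2022, §3.2] -/
theorem tensorRank_kroneckerPow_apTensor_eq (n : ℕ) :
    tensorRank (kroneckerPow apTensor n) = tensorRank (kroneckerPow (cwTensor ℂ 2) n) :=
  le_antisymm (cwTensor_two_restrictsTo_apTensor.kroneckerPow n).tensorRank_le
    (apTensor_restrictsTo_cwTensor_two.kroneckerPow n).tensorRank_le

/-! ## Door D1 for the progression tensor -/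

/-- **Door D1, additive form: `R̃(AP) ≤ 3 ⇒ ω = 2`.** [cite: CoppersmithWinograd1990, §11] -/
theorem matrixMultiplication_of_asymptoticRank_apTensor_le_three (h : asymptoticRank apTensor ≤ 3) :
    _root_.MatrixMultiplication :=
  matrixMultiplication_of_asymptoticRank_cwTensor_two_le_three (asymptoticRank_apTensor_eq ▸ h)

/-- `R̃(AP) ≤ 3 ↔ R̃(T_{cw,2}) ≤ 3` (the door is the same door). [cite: CoppersmithWinograd1990, §11] -/
theorem asymptoticRank_apTensor_le_three_iff :
    asymptoticRank apTensor ≤ 3 ↔ asymptoticRank (cwTensor ℂ 2) ≤ 3 := by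
  rw [asymptoticRank_apTensor_eq]

/-- **D1 as progression certificates**: `R̃(AP) ≤ 3 ⟺ ∀ ε > 0 ∃ n ≥ 1, bR(AP^{⊠n}) ≤ (3+ε)ⁿ` —
`ω = 2` follows if the nontrivial-progression tensor of `𝔽₃ⁿ` has `ℂ`-border rank `3^{n+o(n)}`.
[cite: CoppersmithWinograd1990, §11] [cite: ChristandlVranaZuiddam2021, Rem. 20] -/
theorem asymptoticRank_apTensor_le_three_iff_certificates :
    asymptoticRank apTensor ≤ 3 ↔
      ∀ ε : ℝ, 0 < ε → ∃ n : ℕ, 0 < n ∧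
        (algBorderRank (kroneckerPow apTensor n) : ℝ) ≤ (3 + ε) ^ n := by
  rw [asymptoticRank_apTensor_eq, asymptoticRank_cwTensor_two_le_three_iff_certificates]
  simp only [algBorderRank_kroneckerPow_apTensor_eq]

/-- **Progression certificates prove `ω = 2`.** [cite: CoppersmithWinograd1990, §11] -/
theorem matrixMultiplication_of_apTensor_certificates
    (h : ∀ ε : ℝ, 0 < ε → ∃ n : ℕ, 0 < n ∧
      (algBorderRank (kroneckerPow apTensor n) : ℝ) ≤ (3 + ε) ^ n) :
    _root_.MatrixMultiplication :=
  matrixMultiplication_of_asymptoticRank_apTensor_le_three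
    (asymptoticRank_apTensor_le_three_iff_certificates.2 h)

/-- **Kernel window for `AP`**: `3 ≤ R̃(AP) ≤ 4`; `3ⁿ < bR(AP^{⊠n})` for every `n ≥ 1` (no exact
certificate at any finite level); `48 ≤ bR(AP^{⊠3})`.
[cite: ChristandlVranaZuiddam2023, Example 1.4] [cite: ConnerGesmundoLandsbergVentura2022, Thm. 1.2 (iii)] -/
theorem apTensor_window :
    (3 : ℝ) ≤ asymptoticRank apTensor ∧ asymptoticRank apTensor ≤ 4 ∧
      (∀ n : ℕ, 1 ≤ n → 3 ^ n < algBorderRank (kroneckerPow apTensor n)) ∧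
      48 ≤ algBorderRank (kroneckerPow apTensor 3) := by
  refine ⟨?_, ?_, fun n hn => ?_, ?_⟩
  · rw [asymptoticRank_apTensor_eq]; exact cwTensor_two_asymptotic_sandwich.2.1
  · rw [asymptoticRank_apTensor_eq]; exact cwTensor_two_asymptotic_sandwich.2.2
  · rw [algBorderRank_kroneckerPow_apTensor_eq]
    exact three_pow_lt_algBorderRank_kroneckerPow_cwTensor_two hn
  · rw [algBorderRank_kroneckerPow_apTensor_eq]
    exact le_algBorderRank_kroneckerPow_cwTensor_two_three_p4

end

end Summit.MatrixMultiplication.MatrixMultiplication.Theorems.ThreeAP
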